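import Mathlib
import HarnessLib
import Summits.AtomisticToContinuum.Crystallization.Theorems.PricedLinkCensusSoftLayerPropagationStubBallPropagationRecursionStep

/-!
# Local layer-propagation lemmas for the finite-ball form of Hales, *Dense Sphere Packings* §1.3 (XII):
# the certified layers are the layers of a Barlow stacking

Route `PricedLinkCensus`, crux `SoftLayerPropagation` (stmt-AtomisticToContinuum-14233), line
`Sketch`, twelfth helper file for the stub `stub_ballPropagation` (uses `…Recursion.lean`).

`layers_up` and `layers_down` produce two sign sequences `s⁺, s⁻ : ℕ → {±1}` (as reals) and
certify, on discs, the layers `ℤu₁ + ℤu₂ + (s 0 + ⋯ + s n) w ± (n+1) 𝗁e₃`.  Here they are spliced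
into one Hägg sequence `s : ℤ → ℤ` (`s k = s⁺ k` for `k ≥ 0`, `s (−(m+1)) = −s⁻ m`, as in the
tree's `exists_barlowStacking_subset`) whose label function `haggLabel s` reproduces the two
partial sums (`exists_haggSeq_of_signs`), so that the certified points are exactly the points
`barlowPos 2 𝗁 s k i j` of `BarlowStacking.lean`; with the ring lemma `add_mem_of_ring` the
stacking points of the wider rings are centres as well (`barlowPos_mem_of_layers`).

All statements are elementary ([folklore]).
-/

noncomputable section

namespace Summit.AtomisticToContinuum.Crystallization.Theorems

open Literature.Geometry.DiscreteGeometry Literature.MathematicalPhysics.StatisticalMechanics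
open RealInnerProductSpace

/-! ### Splicing two sign sequences into a Hägg sequence -/

/-- **The Hägg sequence of the two half-stackings.**  Given sign sequences `s⁺, s⁻` (reals `±1`)
there is a Hägg sequence `s : ℤ → ℤ` with `s k = s⁺ k` (`k ≥ 0`), `s (−(m+1)) = −s⁻ m`, whose labels
are `haggLabel s n = s⁺ 0 + ⋯ + s⁺ (n−1)` and `haggLabel s (−n) = s⁻ 0 + ⋯ + s⁻ (n−1)`. [folklore] -/
theorem exists_haggSeq_of_signs (sp sm : ℕ → ℝ) (hsp : ∀ n, sp n = 1 ∨ sp n = -1)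
    (hsm : ∀ n, sm n = 1 ∨ sm n = -1) :
    ∃ s : ℤ → ℤ, IsHaggSeq s ∧
      (∀ n : ℕ, ((haggLabel s n : ℤ) : ℝ) = ∑ m ∈ Finset.range n, sp m) ∧
      (∀ n : ℕ, ((haggLabel s (-(n : ℤ)) : ℤ) : ℝ) = ∑ m ∈ Finset.range n, sm m) ∧
      (∀ n : ℕ, ((s n : ℤ) : ℝ) = sp n) ∧ (∀ n : ℕ, ((s (-((n : ℤ) + 1)) : ℤ) : ℝ) = -sm n) := by
  classical
  let toZ : ℝ → ℤ := fun r => if r = 1 then 1 else -1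
  have toZ_cast : ∀ r : ℝ, (r = 1 ∨ r = -1) → ((toZ r : ℤ) : ℝ) = r := by
    intro r hr
    rcases hr with rfl | rfl
    · simp [toZ]
    · simp only [toZ]; norm_num
  have toZ_sign : ∀ r : ℝ, toZ r = 1 ∨ toZ r = -1 := fun r => by
    simp only [toZ]; split_ifs <;> simp
  let s : ℤ → ℤ := fun k => if 0 ≤ k then toZ (sp k.toNat) else -toZ (sm (-k - 1).toNat)
  have s_nat : ∀ n : ℕ, s n = toZ (sp n) := fun n => by
    simp only [s, if_pos (Int.natCast_nonneg n), Int.toNat_natCast]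
  have s_neg : ∀ n : ℕ, s (-((n : ℤ) + 1)) = -toZ (sm n) := fun n => by
    have h1 : ¬ (0 : ℤ) ≤ -((n : ℤ) + 1) := by omega
    have h2 : (-(-((n : ℤ) + 1)) - 1).toNat = n := by simp
    simp only [s, if_neg h1, h2]
  refine ⟨s, fun k => ?_, fun n => ?_, fun n => ?_, fun n => ?_, fun n => ?_⟩
  · by_cases hk : 0 ≤ k
    · simp only [s, if_pos hk]; exact toZ_sign _
    · simp only [s, if_neg hk]
      rcases toZ_sign (sm (-k - 1).toNat) with h | h <;> rw [h] <;> norm_num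
  · rw [haggLabel_natCast, haggWindow]
    push_cast
    refine Finset.sum_congr rfl fun m _ => ?_
    rw [zero_add, s_nat, toZ_cast _ (hsp m)]
  · rw [haggLabel_neg_natCast, haggWindow]
    have e : ∑ i ∈ Finset.range n, s (-(n : ℤ) + i) = ∑ m ∈ Finset.range n, -toZ (sm m) := by
      rw [← Finset.sum_range_reflect (fun m => -toZ (sm m)) n]
      refine Finset.sum_congr rfl fun i hi => ?_
      have hi' := Finset.mem_range.1 hi
      have : -(n : ℤ) + i = -(((n - 1 - i : ℕ) : ℤ) + 1) := by push_cast [Nat.sub_sub, Nat.cast_sub (by omega : 1 + i ≤ n)]; ring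
      rw [this, s_neg]
    rw [e]
    push_cast
    rw [Finset.sum_neg_distrib, neg_neg]
    exact Finset.sum_congr rfl fun m _ => toZ_cast _ (hsm m)
  · rw [s_nat, toZ_cast _ (hsp n)]
  · rw [s_neg]; push_cast; rw [toZ_cast _ (hsm n)]

/-! ### The certified points are stacking points -/

section Stacking

variable {V : Set (EuclideanSpace ℝ (Fin 3))}

/-- **The certified layers and their rings are centres, as points of the Barlow stacking.**  Given
the base disc (`hbase`), the outputs of `layers_up` (`hup`) and `layers_down` (`hdown`) with the
spliced Hägg sequence `s` of `exists_haggSeq_of_signs`, and ring hypotheses `hR⁺, hR⁻` for all the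
layers, every stacking point `barlowPos 2 𝗁 s k i j` with `0 ≤ k ≤ N⁺` (resp. `−N⁻ ≤ k < 0`) at
horizontal distance `≤ R⁺ k` (resp. `R⁻ (−k)`) from the axis is a centre (`add_mem_of_ring`).
[folklore] -/
theorem barlowPos_mem_of_layers {c : EuclideanSpace ℝ (Fin 3)} (hc : c 2 = 0)
    (Np Nm : ℕ) (ρp Rp ρm Rm : ℕ → ℝ) (hρp : ∀ n ≤ Np, 0 ≤ ρp n) (hρm : ∀ n ≤ Nm, 0 ≤ ρm n)
    (hRp : ∀ n ≤ Np, ∀ r : ℝ, ρp n < r → r ≤ Rp n →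
      ∃ t : ℝ, 0 < t ∧ 4 / 3 * t ^ 2 < r ^ 2 ∧ r ^ 2 - (4 * t - 4) ≤ ρp n ^ 2)
    (hRm : ∀ n ≤ Nm, ∀ r : ℝ, ρm n < r → r ≤ Rm n →
      ∃ t : ℝ, 0 < t ∧ 4 / 3 * t ^ 2 < r ^ 2 ∧ r ^ 2 - (4 * t - 4) ≤ ρm n ^ 2)
    {σ₀ σ₀' : ℝ} (s : ℤ → ℤ) (sp sm : ℕ → ℝ)
    (hLp : ∀ n : ℕ, ((haggLabel s n : ℤ) : ℝ) = ∑ m ∈ Finset.range n, sp m)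
    (hLm : ∀ n : ℕ, ((haggLabel s (-(n : ℤ)) : ℤ) : ℝ) = ∑ m ∈ Finset.range n, sm m)
    (hbase : ∀ i j : ℤ,
      ‖((i : ℝ) • (triangularVec₁ 2 : EuclideanSpace ℝ (Fin 3)) + (j : ℝ) • triangularVec₂ 2) - c‖ ≤ ρp 0 →
      (i : ℝ) • (triangularVec₁ 2 : EuclideanSpace ℝ (Fin 3)) + (j : ℝ) • triangularVec₂ 2 ∈ V ∧
      kissingShell V ((i : ℝ) • (triangularVec₁ 2 : EuclideanSpace ℝ (Fin 3)) + (j : ℝ) • triangularVec₂ 2)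
        = layerShell σ₀ σ₀')
    (hup : ∀ n < Np, ∀ i j : ℤ,
        ‖((i : ℝ) • (triangularVec₁ 2 : EuclideanSpace ℝ (Fin 3)) + (j : ℝ) • triangularVec₂ 2 +
            (∑ m ∈ Finset.range (n + 1), sp m) • barlowOffset 2) - c‖ ≤ ρp (n + 1) →
        (i : ℝ) • (triangularVec₁ 2 : EuclideanSpace ℝ (Fin 3)) + (j : ℝ) • triangularVec₂ 2 +
            (∑ m ∈ Finset.range (n + 1), sp m) • barlowOffset 2 +
            ((n : ℝ) + 1) • layerNormal layerSpacing ∈ V ∧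
        kissingShell V ((i : ℝ) • (triangularVec₁ 2 : EuclideanSpace ℝ (Fin 3)) + (j : ℝ) • triangularVec₂ 2 +
            (∑ m ∈ Finset.range (n + 1), sp m) • barlowOffset 2 +
            ((n : ℝ) + 1) • layerNormal layerSpacing) = layerShell (sp (n + 1)) (-(sp n)))
    (hdown : ∀ n < Nm, ∀ i j : ℤ,
        ‖((i : ℝ) • (triangularVec₁ 2 : EuclideanSpace ℝ (Fin 3)) + (j : ℝ) • triangularVec₂ 2 +
            (∑ m ∈ Finset.range (n + 1), sm m) • barlowOffset 2) - c‖ ≤ ρm (n + 1) →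
        (i : ℝ) • (triangularVec₁ 2 : EuclideanSpace ℝ (Fin 3)) + (j : ℝ) • triangularVec₂ 2 +
            (∑ m ∈ Finset.range (n + 1), sm m) • barlowOffset 2 -
            ((n : ℝ) + 1) • layerNormal layerSpacing ∈ V ∧
        kissingShell V ((i : ℝ) • (triangularVec₁ 2 : EuclideanSpace ℝ (Fin 3)) + (j : ℝ) • triangularVec₂ 2 +
            (∑ m ∈ Finset.range (n + 1), sm m) • barlowOffset 2 -
            ((n : ℝ) + 1) • layerNormal layerSpacing) = layerShell (-(sm n)) (sm (n + 1))) :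
    (∀ n : ℕ, n ≤ Np → ∀ i j : ℤ,
      ‖((i : ℝ) • (triangularVec₁ 2 : EuclideanSpace ℝ (Fin 3)) + (j : ℝ) • triangularVec₂ 2 +
          ((haggLabel s n : ℤ) : ℝ) • barlowOffset 2) - c‖ ≤ Rp n →
      barlowPos 2 layerSpacing s n i j ∈ V) ∧
    (∀ n : ℕ, 1 ≤ n → n ≤ Nm → ∀ i j : ℤ,
      ‖((i : ℝ) • (triangularVec₁ 2 : EuclideanSpace ℝ (Fin 3)) + (j : ℝ) • triangularVec₂ 2 +
          ((haggLabel s (-(n : ℤ)) : ℤ) : ℝ) • barlowOffset 2) - c‖ ≤ Rm n →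
      barlowPos 2 layerSpacing s (-(n : ℤ)) i j ∈ V) := by
  set Lat : ℤ → ℤ → EuclideanSpace ℝ (Fin 3) := fun i j =>
    (i : ℝ) • (triangularVec₁ 2 : EuclideanSpace ℝ (Fin 3)) + (j : ℝ) • triangularVec₂ 2 with hLat
  -- the generic ring step for a certified layer with offset `o` and horizontal shift `Lw`
  have ring : ∀ (Lw : ℝ) (o : EuclideanSpace ℝ (Fin 3)) (ρ R σ σ' : ℝ), 0 ≤ ρ →
      (∀ r : ℝ, ρ < r → r ≤ R → ∃ t : ℝ, 0 < t ∧ 4 / 3 * t ^ 2 < r ^ 2 ∧ r ^ 2 - (4 * t - 4) ≤ ρ ^ 2) →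
      (∀ i j : ℤ, ‖Lat i j + Lw • barlowOffset 2 - c‖ ≤ ρ →
        o + Lat i j ∈ V ∧ kissingShell V (o + Lat i j) = layerShell σ σ') →
      ∀ i j : ℤ, ‖Lat i j + Lw • barlowOffset 2 - c‖ ≤ R → o + Lat i j ∈ V := by
    intro Lw o ρ R σ σ' hρ hR hfull i j hij
    have hc' : (c - Lw • barlowOffset 2) 2 = 0 := by simp [hc]
    have e : ∀ i j : ℤ, Lat i j + Lw • barlowOffset 2 - c = Lat i j - (c - Lw • barlowOffset 2) :=
      fun i j => by abel
    refine add_mem_of_ring hc' (ρ := ρ) (R := R) (fun i j h => ?_) hR hρ i j (by rw [← e]; exact hij)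
    rw [← e] at h
    exact ⟨(hfull i j h).1, add_mem_of_kissingShell_eq_layerShell (hfull i j h).2⟩
  refine ⟨fun n hn i j hij => ?_, fun n hn1 hn i j hij => ?_⟩
  · -- layers `0 ≤ n ≤ N⁺`
    rcases Nat.eq_zero_or_pos n with rfl | hpos
    · have e1 : barlowPos 2 layerSpacing s ((0 : ℕ) : ℤ) i j = (0 : EuclideanSpace ℝ (Fin 3)) + Lat i j := by
        simp [barlowPos, hLat]
      rw [e1]
      refine ring 0 0 (ρp 0) (Rp 0) σ₀ σ₀' (hρp 0 (Nat.zero_le _)) (hRp 0 (Nat.zero_le _))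
        (fun i j h => ?_) i j (by simpa using hij)
      rw [zero_add]
      exact hbase i j (by simpa using h)
    · obtain ⟨m, rfl⟩ : ∃ m, n = m + 1 := ⟨n - 1, by omega⟩
      have hm : m < Np := Nat.lt_of_succ_le hn
      set o : EuclideanSpace ℝ (Fin 3) := (∑ k ∈ Finset.range (m + 1), sp k) • barlowOffset 2 +
        ((m : ℝ) + 1) • layerNormal layerSpacing with ho
      have hL' : ((haggLabel s ((m + 1 : ℕ) : ℤ) : ℤ) : ℝ) = ∑ k ∈ Finset.range (m + 1), sp k := hLp (m + 1)
      have e1 : barlowPos 2 layerSpacing s ((m + 1 : ℕ) : ℤ) i j = o + Lat i j := by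
        simp only [barlowPos, ho, hLat]
        rw [hL']; push_cast; module
      rw [e1]
      refine ring (∑ k ∈ Finset.range (m + 1), sp k) o (ρp (m + 1)) (Rp (m + 1)) (sp (m + 1)) (-(sp m))
        (hρp _ hn) (hRp _ hn) (fun i j h => ?_) i j (by rw [hL'] at hij; exact hij)
      have := hup m hm i j h
      have e2 : o + Lat i j = Lat i j + (∑ k ∈ Finset.range (m + 1), sp k) • barlowOffset 2 +
          ((m : ℝ) + 1) • layerNormal layerSpacing := by rw [ho]; abel
      rw [e2]; exact this
  · -- layers `−N⁻ ≤ −n ≤ −1`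
    obtain ⟨m, rfl⟩ : ∃ m, n = m + 1 := ⟨n - 1, by omega⟩
    have hm : m < Nm := Nat.lt_of_succ_le hn
    set o : EuclideanSpace ℝ (Fin 3) := (∑ k ∈ Finset.range (m + 1), sm k) • barlowOffset 2 -
      ((m : ℝ) + 1) • layerNormal layerSpacing with ho
    have hL' : ((haggLabel s (-((m + 1 : ℕ) : ℤ)) : ℤ) : ℝ) = ∑ k ∈ Finset.range (m + 1), sm k := hLm (m + 1)
    have e1 : barlowPos 2 layerSpacing s (-((m + 1 : ℕ) : ℤ)) i j = o + Lat i j := by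
      simp only [barlowPos, ho, hLat]
      rw [hL']; push_cast; module
    rw [e1]
    refine ring (∑ k ∈ Finset.range (m + 1), sm k) o (ρm (m + 1)) (Rm (m + 1)) (-(sm m)) (sm (m + 1))
      (hρm _ hn) (hRm _ hn) (fun i j h => ?_) i j (by rw [hL'] at hij; exact hij)
    have := hdown m hm i j h
    have e2 : o + Lat i j = Lat i j + (∑ k ∈ Finset.range (m + 1), sm k) • barlowOffset 2 -
        ((m : ℝ) + 1) • layerNormal layerSpacing := by rw [ho]; abel
    rw [e2]; exact this

end Stacking

/-- **Registered sub-goal `ballPropagation_haggSplice`** of the crux item (the spliced Hägg sequence, in closed form: `exists_haggSeq_of_signs`). [folklore] -/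
theorem ballPropagation_haggSplice :
    ∀ (sp sm : ℕ → ℝ), (∀ n, sp n = 1 ∨ sp n = -1) → (∀ n, sm n = 1 ∨ sm n = -1) → ∃ s : ℤ → ℤ,
    Literature.MathematicalPhysics.StatisticalMechanics.IsHaggSeq s ∧ (∀ n : ℕ,
    ((Literature.MathematicalPhysics.StatisticalMechanics.haggLabel s n : ℤ) : ℝ) = ∑ m ∈
    Finset.range n, sp m) ∧ (∀ n : ℕ,
    ((Literature.MathematicalPhysics.StatisticalMechanics.haggLabel s (-(n : ℤ)) : ℤ) : ℝ) = ∑ m ∈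
    Finset.range n, sm m) ∧ (∀ n : ℕ, ((s n : ℤ) : ℝ) = sp n) ∧ (∀ n : ℕ, ((s (-((n : ℤ) + 1)) : ℤ)
    : ℝ) = -sm n) :=
  fun sp sm hsp hsm => exists_haggSeq_of_signs sp sm hsp hsm

end Summit.AtomisticToContinuum.Crystallization.Theorems

end
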